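import Mathlib
import Summits.NavierStokesRegularity.NavierStokesRegularity.Theorems.TaoLadderRungTwoBreakBlowupRigidityOneMixedDrainPairWake
import HarnessLib

/-!
# SIGN-FREE WAKE IDENTITIES of the mixed-drain pair `M(u,v)`: along ANY exact inviscid flow from a one-shell datum the
  partial energy `S_n`, the drain defect `D_n = (u/v) b_n − a_n` and the wake defect
  `V_n = (u/v)² b_n² − a_n² − (E₀ − S_n)` evolve by `Ṡ_n = −4Λ_n a_n b_n G_{n+1}`, `Ḋ_n = 2Λ_n b_n G_{n+1}`, `V̇_n = 2u F_{n−1} D_n`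
  (`F_{n−1} = 2Λ_{n−1}a_{n−1}b_{n−1}`, `G_{n+1} = u a_{n+1} + v b_{n+1}`) — the bookkeeping behind the orthant wake floor of
  `…MixedDrainPairWake`, WITHOUT sign hypotheses, for the sign-change analysis that census item (MP) of K2(1)
  `TaoLadderRungTwoBreak.BlowupRigidityOne` now needs (stmt-NavierStokesRegularity-20206; `--supports`)

MODEL lattice ODEs only (Tao 2016 §4 (4.3), Lemma 4.1 (4.8)–(4.10)); nothing here is a statement about the Navier–Stokes
equations; NO item is closed.  DEF-FREE; ROUTE-INDEPENDENT MODULE (no `Theses` import).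

* `hasDerivWithinAt_b_mixedDrainPair`, `hasDerivWithinAt_a_mixedDrainPair` — the exact laws `ḃ_n = v F_{n−1}`,
  `ȧ_n = u F_{n−1} − 2Λ_n b_n G_{n+1}` in `bigLam` form;
* `hasDerivWithinAt_partialEnergy_mixedDrainPair` — `Ṡ_n = −2Λ_n · 2 a_n b_n G_{n+1}` (telescoped shell balances);
* `hasDerivWithinAt_drainDefect_mixedDrainPair` — `Ḋ_n = 2Λ_n b_n G_{n+1}`: the drain defect moves only by the drain;
* `hasDerivWithinAt_wakeDefect_mixedDrainPair` — `V̇_n = 2u F_{n−1} D_n`: the wake defect moves only by feed × drain defect.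
With signs (`F ≥ 0`, `b_n G_{n+1} ≥ 0`) these give the orthant wake floor; without signs they say exactly which correlations
(`F_{n−1}` against `D_n`) an «AC transmission» would have to exploit to pass energy up with a small wake.

HONEST LABEL: calculus identities for one explicit table family; no stub, crux, rung or summit is proved; rung 0.
-/

noncomputable section

-- the summit and its single sub-problem share the name (CONVENTIONS §1)
set_option linter.dupNamespace false

open Set Filter Topology MeasureTheory
open scoped RealInnerProductSpace

namespace Summit.NavierStokesRegularity.NavierStokesRegularity.Theorems

namespace BlowupRigidityOne

open Literature.Analysis.FluidPDE Literature.Analysis.FluidPDE.TaoCascade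

/-- **`ḃ_n = v F_{n−1}`** for an exact flow of `M(u,v)`: `F_{n−1} = 2Λ^{n−1} a_{n−1} b_{n−1}`.
[cite: Tao2016AveragedNS, §4 Lemma 4.1 (4.8); cell vocabulary (census item (MP))] -/
theorem hasDerivWithinAt_b_mixedDrainPair {u v ε₀ T : ℝ} (hε : 0 < ε₀) {X : Fin 4 → ℤ → ℝ → ℝ}
    (hder : ∀ i k, ∀ t ∈ Ico 0 T, HasDerivWithinAt (X i k) (quadTerm ε₀ (fun (i₁ i₂ i₃ : Fin 4) (μ : ℤ × ℤ × ℤ) => if μ = ((0 : ℤ), (0 : ℤ), (1 : ℤ)) then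
        (if (i₁ = 0 ∧ i₂ = 1) ∨ (i₁ = 1 ∧ i₂ = 0) then (if i₃ = 0 then u else if i₃ = 1 then v else 0) else 0)
      else if μ = ((1 : ℤ), (0 : ℤ), (0 : ℤ)) then
        (if i₁ = 0 ∧ i₂ = 1 ∧ i₃ = 0 then -u else if i₁ = 1 ∧ i₂ = 1 ∧ i₃ = 0 then -v else 0)
      else if μ = ((0 : ℤ), (1 : ℤ), (0 : ℤ)) then
        (if i₁ = 1 ∧ i₂ = 0 ∧ i₃ = 0 then -u else if i₁ = 1 ∧ i₂ = 1 ∧ i₃ = 0 then -v else 0) else 0) X i k t) (Ici 0) t)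
    (n : ℤ) {τ : ℝ} (hτ : τ ∈ Ico 0 T) :
    HasDerivWithinAt (X 1 n)
      (v * (2 * bigLam ε₀ ^ (n - 1) * (X 0 (n - 1) τ * X 1 (n - 1) τ))) (Ici 0) τ := by
  have h1ε : 0 < 1 + ε₀ := by linarith
  have h := hder 1 n τ hτ
  rw [quadTerm_mixedDrainPair, if_neg (show (1 : Fin 4) ≠ 0 by decide), if_pos rfl] at h
  refine h.congr_deriv ?_
  have hg := DSSOneShift.bigLam_zpow_eq_rpow h1ε (n - 1)
  push_cast at hg
  rw [hg]
  ring

/-- **`ȧ_n = u F_{n−1} − 2Λ^n b_n G_{n+1}`** for an exact flow of `M(u,v)`: `G_{n+1} = u a_{n+1} + v b_{n+1}`.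
[cite: Tao2016AveragedNS, §4 Lemma 4.1 (4.8); cell vocabulary (census item (MP))] -/
theorem hasDerivWithinAt_a_mixedDrainPair {u v ε₀ T : ℝ} (hε : 0 < ε₀) {X : Fin 4 → ℤ → ℝ → ℝ}
    (hder : ∀ i k, ∀ t ∈ Ico 0 T, HasDerivWithinAt (X i k) (quadTerm ε₀ (fun (i₁ i₂ i₃ : Fin 4) (μ : ℤ × ℤ × ℤ) => if μ = ((0 : ℤ), (0 : ℤ), (1 : ℤ)) then
        (if (i₁ = 0 ∧ i₂ = 1) ∨ (i₁ = 1 ∧ i₂ = 0) then (if i₃ = 0 then u else if i₃ = 1 then v else 0) else 0)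
      else if μ = ((1 : ℤ), (0 : ℤ), (0 : ℤ)) then
        (if i₁ = 0 ∧ i₂ = 1 ∧ i₃ = 0 then -u else if i₁ = 1 ∧ i₂ = 1 ∧ i₃ = 0 then -v else 0)
      else if μ = ((0 : ℤ), (1 : ℤ), (0 : ℤ)) then
        (if i₁ = 1 ∧ i₂ = 0 ∧ i₃ = 0 then -u else if i₁ = 1 ∧ i₂ = 1 ∧ i₃ = 0 then -v else 0) else 0) X i k t) (Ici 0) t)
    (n : ℤ) {τ : ℝ} (hτ : τ ∈ Ico 0 T) :
    HasDerivWithinAt (X 0 n)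
      (u * (2 * bigLam ε₀ ^ (n - 1) * (X 0 (n - 1) τ * X 1 (n - 1) τ)) -
        2 * bigLam ε₀ ^ n * (X 1 n τ * (u * X 0 (n + 1) τ + v * X 1 (n + 1) τ))) (Ici 0) τ := by
  have h1ε : 0 < 1 + ε₀ := by linarith
  have h := hder 0 n τ hτ
  rw [quadTerm_mixedDrainPair, if_pos rfl] at h
  refine h.congr_deriv ?_
  have hg := DSSOneShift.bigLam_zpow_eq_rpow h1ε (n - 1)
  have hg' := DSSOneShift.bigLam_zpow_eq_rpow h1ε n
  push_cast at hg hg'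
  rw [hg, hg']
  ring

/-- **`Ṡ_n = −2Λ^n · 2 a_n b_n G_{n+1}`**: the partial energy `S_n = Σ_{j≤n} ‖x_j‖²` of an exact flow of `M(u,v)` (no shells below
`0`) loses exactly the flux `2Λ^n⟪x_{n+1}, A x_n⟫`, and for `M(u,v)` that pairing is `G_{n+1} · 2 a_n b_n`.
[cite: Tao2016AveragedNS, §4 (4.3), Lemma 4.1 (4.9)–(4.10); cell vocabulary (census item (MP))] -/
theorem hasDerivWithinAt_partialEnergy_mixedDrainPair {u v ε₀ T : ℝ} (hε : 0 < ε₀) {X : Fin 4 → ℤ → ℝ → ℝ}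
    (hder : ∀ i k, ∀ t ∈ Ico 0 T, HasDerivWithinAt (X i k) (quadTerm ε₀ (fun (i₁ i₂ i₃ : Fin 4) (μ : ℤ × ℤ × ℤ) => if μ = ((0 : ℤ), (0 : ℤ), (1 : ℤ)) then
        (if (i₁ = 0 ∧ i₂ = 1) ∨ (i₁ = 1 ∧ i₂ = 0) then (if i₃ = 0 then u else if i₃ = 1 then v else 0) else 0)
      else if μ = ((1 : ℤ), (0 : ℤ), (0 : ℤ)) then
        (if i₁ = 0 ∧ i₂ = 1 ∧ i₃ = 0 then -u else if i₁ = 1 ∧ i₂ = 1 ∧ i₃ = 0 then -v else 0)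
      else if μ = ((0 : ℤ), (1 : ℤ), (0 : ℤ)) then
        (if i₁ = 1 ∧ i₂ = 0 ∧ i₃ = 0 then -u else if i₁ = 1 ∧ i₂ = 1 ∧ i₃ = 0 then -v else 0) else 0) X i k t) (Ici 0) t)
    (hlow : ∀ i k t, k < 0 → X i k t = 0) (n : ℕ) {τ : ℝ} (hτ : τ ∈ Ico 0 T) :
    HasDerivWithinAt (fun s => ∑ j ∈ Finset.range (n + 1), ‖shellVec X (j : ℤ) s‖ ^ 2)
      (-(2 * bigLam ε₀ ^ (n : ℤ) * (2 * X 0 n τ * (X 1 n τ * (u * X 0 ((n : ℤ) + 1) τ + v * X 1 ((n : ℤ) + 1) τ)))))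
      (Ici 0) τ := by
  have hc := isCancellingCoeff_mixedDrainPair u v
  have hxneg : shellVec X (-1) τ = 0 := by
    ext i; simp [shellVec, hlow i (-1) τ (by norm_num)]
  set g : ℤ → ℝ := fun j => 2 * bigLam ε₀ ^ j * ⟪shellVec X (j + 1) τ, tableA (fun (i₁ i₂ i₃ : Fin 4) (μ : ℤ × ℤ × ℤ) => if μ = ((0 : ℤ), (0 : ℤ), (1 : ℤ)) then
        (if (i₁ = 0 ∧ i₂ = 1) ∨ (i₁ = 1 ∧ i₂ = 0) then (if i₃ = 0 then u else if i₃ = 1 then v else 0) else 0)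
      else if μ = ((1 : ℤ), (0 : ℤ), (0 : ℤ)) then
        (if i₁ = 0 ∧ i₂ = 1 ∧ i₃ = 0 then -u else if i₁ = 1 ∧ i₂ = 1 ∧ i₃ = 0 then -v else 0)
      else if μ = ((0 : ℤ), (1 : ℤ), (0 : ℤ)) then
        (if i₁ = 1 ∧ i₂ = 0 ∧ i₃ = 0 then -u else if i₁ = 1 ∧ i₂ = 1 ∧ i₃ = 0 then -v else 0) else 0) (shellVec X j τ)⟫ with hgdef
  have hterm : ∀ j ∈ Finset.range (n + 1), HasDerivWithinAt (fun s => ‖shellVec X (j : ℤ) s‖ ^ 2)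
      (g ((j : ℤ) - 1) - g j) (Ici 0) τ := by
    intro j _
    have h := shellEnergy_hasDerivWithinAt hε hc (k := (j : ℤ)) (fun i => hder i j τ hτ)
    simp only [hgdef, sub_add_cancel]
    exact h
  have hsum := HasDerivWithinAt.sum hterm
  have hg1 : g (-1) = 0 := by
    simp only [hgdef]
    rw [hxneg, tableA_zero hc, inner_zero_right, mul_zero]
  have htel : ∑ j ∈ Finset.range (n + 1), (g ((j : ℤ) - 1) - g j) = -(g n) := by
    have h := Finset.sum_range_sub' (fun j : ℕ => g ((j : ℤ) - 1)) (n + 1)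
    have e : ∀ j : ℕ, g (((j + 1 : ℕ) : ℤ) - 1) = g (j : ℤ) := fun j => by
      congr 1; push_cast; ring
    simp only [e] at h
    rw [h]
    push_cast
    rw [hg1, zero_sub]
  rw [htel, Finset.sum_fn] at hsum
  refine hsum.congr_deriv ?_
  simp only [hgdef, inner_tableA_mixedDrainPair, shellVec_apply]
  ring

/-- **`Ḋ_n = 2Λ^n b_n G_{n+1}`**: the drain defect `D_n = (u/v) b_n − a_n` of an exact flow of `M(u,v)` (`v ≠ 0`) is insensitive
to the feed (which enters `a_n` and `b_n` in the ratio `u : v`) and moves only by the drain.  No sign hypothesis.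
[cite: Tao2016AveragedNS, §4 Lemma 4.1 (4.8); cell vocabulary (census item (MP))] -/
theorem hasDerivWithinAt_drainDefect_mixedDrainPair {u v ε₀ T : ℝ} (hv : v ≠ 0) (hε : 0 < ε₀) {X : Fin 4 → ℤ → ℝ → ℝ}
    (hder : ∀ i k, ∀ t ∈ Ico 0 T, HasDerivWithinAt (X i k) (quadTerm ε₀ (fun (i₁ i₂ i₃ : Fin 4) (μ : ℤ × ℤ × ℤ) => if μ = ((0 : ℤ), (0 : ℤ), (1 : ℤ)) then
        (if (i₁ = 0 ∧ i₂ = 1) ∨ (i₁ = 1 ∧ i₂ = 0) then (if i₃ = 0 then u else if i₃ = 1 then v else 0) else 0)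
      else if μ = ((1 : ℤ), (0 : ℤ), (0 : ℤ)) then
        (if i₁ = 0 ∧ i₂ = 1 ∧ i₃ = 0 then -u else if i₁ = 1 ∧ i₂ = 1 ∧ i₃ = 0 then -v else 0)
      else if μ = ((0 : ℤ), (1 : ℤ), (0 : ℤ)) then
        (if i₁ = 1 ∧ i₂ = 0 ∧ i₃ = 0 then -u else if i₁ = 1 ∧ i₂ = 1 ∧ i₃ = 0 then -v else 0) else 0) X i k t) (Ici 0) t)
    (n : ℤ) {τ : ℝ} (hτ : τ ∈ Ico 0 T) :
    HasDerivWithinAt (fun s => u / v * X 1 n s - X 0 n s)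
      (2 * bigLam ε₀ ^ n * (X 1 n τ * (u * X 0 (n + 1) τ + v * X 1 (n + 1) τ))) (Ici 0) τ := by
  have h := ((hasDerivWithinAt_b_mixedDrainPair hε hder n hτ).const_mul (u / v)).sub
    (hasDerivWithinAt_a_mixedDrainPair hε hder n hτ)
  refine h.congr_deriv ?_
  field_simp
  ring

/-- **`V̇_n = 2u F_{n−1} D_n`**: the wake defect `V_n = (u/v)² b_n² − a_n² − (E₀ − S_n)` of an exact flow of `M(u,v)` (`v ≠ 0`,
no shells below `0`, `n ≥ 0` a natural shell index, `E₀` any constant) moves only by feed × drain defect.  No sign hypothesis;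
with `F_{n−1} ≥ 0 ≤ D_n` it is the monotonicity behind `tailEnergy_add_sq_le_wake_mixedDrainPair`.
[cite: Tao2016AveragedNS, §4 (4.3), Lemma 4.1 (4.8)–(4.10); cell vocabulary (census item (MP))] -/
theorem hasDerivWithinAt_wakeDefect_mixedDrainPair {u v ε₀ T : ℝ} (hv : v ≠ 0) (hε : 0 < ε₀) {X : Fin 4 → ℤ → ℝ → ℝ}
    (hder : ∀ i k, ∀ t ∈ Ico 0 T, HasDerivWithinAt (X i k) (quadTerm ε₀ (fun (i₁ i₂ i₃ : Fin 4) (μ : ℤ × ℤ × ℤ) => if μ = ((0 : ℤ), (0 : ℤ), (1 : ℤ)) then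
        (if (i₁ = 0 ∧ i₂ = 1) ∨ (i₁ = 1 ∧ i₂ = 0) then (if i₃ = 0 then u else if i₃ = 1 then v else 0) else 0)
      else if μ = ((1 : ℤ), (0 : ℤ), (0 : ℤ)) then
        (if i₁ = 0 ∧ i₂ = 1 ∧ i₃ = 0 then -u else if i₁ = 1 ∧ i₂ = 1 ∧ i₃ = 0 then -v else 0)
      else if μ = ((0 : ℤ), (1 : ℤ), (0 : ℤ)) then
        (if i₁ = 1 ∧ i₂ = 0 ∧ i₃ = 0 then -u else if i₁ = 1 ∧ i₂ = 1 ∧ i₃ = 0 then -v else 0) else 0) X i k t) (Ici 0) t)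
    (hlow : ∀ i k t, k < 0 → X i k t = 0) (E₀ : ℝ) (n : ℕ) {τ : ℝ} (hτ : τ ∈ Ico 0 T) :
    HasDerivWithinAt
      (fun s => (u / v) ^ 2 * X 1 n s ^ 2 - X 0 n s ^ 2 -
        (E₀ - ∑ j ∈ Finset.range (n + 1), ‖shellVec X (j : ℤ) s‖ ^ 2))
      (2 * u * (2 * bigLam ε₀ ^ ((n : ℤ) - 1) * (X 0 ((n : ℤ) - 1) τ * X 1 ((n : ℤ) - 1) τ)) *
        (u / v * X 1 n τ - X 0 n τ)) (Ici 0) τ := by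
  have h1 := ((hasDerivWithinAt_b_mixedDrainPair hε hder (n : ℤ) hτ).pow 2).const_mul ((u / v) ^ 2)
  have h2 := (hasDerivWithinAt_a_mixedDrainPair hε hder (n : ℤ) hτ).pow 2
  have h3 := (hasDerivWithinAt_partialEnergy_mixedDrainPair hε hder hlow n hτ).const_sub E₀
  have h := (h1.sub h2).sub h3
  refine h.congr_deriv ?_
  push_cast
  field_simp
  ring

end BlowupRigidityOne

end Summit.NavierStokesRegularity.NavierStokesRegularity.Theorems

end
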